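import Summits.HodgeConjecture.HodgeConjecture.Theorems.F0P3cStCharTSHCDCuspDocking   -- ★ (HC) at `r = 1∕4` (F0P3b-p01); brings ★ (D3c) `…cuspDiscriminant_rpow_neg_lt_top` (parametric `6s < 5`), ★ (CO) FILE 2, ★ (NB), ★ (G-FUB)
import HarnessLib

/-!
# K2 · E3 · (SC-an) sub-line «HC-D-ε», file (ε0): CUSP DOCKING ON `↥A` AT A REAL EXPONENT `r`
# (the cusp integrand `(↑|−4c³ − 27d²|_K)^(−r)` is locally `∫⁻`-finite on the Chevalley target `A = {σ c = c, σ d = −d}` for `12 r < 5`)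

Cell `pub/hodgecm-mathlib`, crux H413 = `stmt-HodgeConjecture-24833` (lane `--supports … --as helper`); seat K2E3-p21 (g3) (HC-D-ε sub-lead), (SC-an) line lead
K2E3-p14 (g3), dealer K2E3-plan (g2).  Exponent-parametric twin of ★ `F0P3cStCharTSHCDCuspDocking` (F0P3b-p01) under the SUB-LINE CONVENTION of (ε5)
★ `K2E3HCDGroupToLieRpow` (exponent `r : ℝ` on the `normAbs K`-token, shape `((↑x : ℝ≥0∞)) ^ (-r)`; at the `F′`-level the exponent is `s = 2r`).  It supplies the `hcusp`
binder of (ε1) `K2E3HCDRegularPointsRpow` (K2E5-p01 (g4)) at the model stage (ε6).  THEOREMS ONLY; sorry-free; no definition ∕ instance ∕ notation.  (The census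
`CENSUS-D4eps` listed this brick as exponent-free — corrected here: it carries the weight, 11 `√`.)

THE MATHEMATICS ([HarishChandra1970] Part VII §1 Thm. 15 — the cusp `|δ|^{−s}` on the Chevalley quotient).  Frame of the ★ file: `K ⊇ ι F′` non-archimedean local fields,
`σ` with fixed field `ι F′` (`ι` a closed embedding), a skew unit `lam`, `2, 3 ≠ 0`, `A ≤ K × K` ANY additive subgroup with `p ∈ A ↔ σ p.1 = p.1 ∧ σ p.2 = −p.2`, `ν` ANY
additive Haar measure on `↥A`.  §1 the bridge `N = n² ⇒ (↑N)^(−r) = (↑n)^(−(2r))` (`ENNReal.rpow_natCast`, `ENNReal.rpow_mul`); §2 through the ★ (CO) chart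
`Φ_A x = (ι x₀, lam · ι x₁)` and ★ (NB) `|ι y|_K = |y|²_{F′}` the integrand reads `(↑|−4x₀³ − 27 m x₁²|_{F′})^(−(2r))`; §3 ★ (D3c)
`forall_exists_nhds_setLIntegral_cuspDiscriminant_rpow_neg_lt_top` at `s = 2r` (`6s < 5 ⟺ 12 r < 5`) on `Fin 2 → F′` and ★ (G-FUB) `…_iff_of_addEquiv Φ_A` give the HEAD
**`forall_exists_nhds_setLIntegral_cusp_rpow_lt_top … {r} (hr5 : 12 * r < 5) : ∀ a₀ : ↥A, ∃ W ∈ 𝓝 a₀, ∫⁻ a in W, (↑|−4 a.1³ − 27 a.2²|_K)^(−r) ∂ν < ∞`**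
(binders = the ★ head + `{r} (hr5)` after `hA`).  The case `r = 1∕4` is ★ (HC) by (ε5) `coe_rpow_neg_quarter`.
HONEST LABEL: count-neutral; closes no organ; HC_CM is proved only modulo the 7 printed citations (2 remaining named inputs: hLiu418 = `stmt-HodgeConjecture-24832`,
h413 = `stmt-HodgeConjecture-24833`) until rung 0 closes; (SC-an) is NOT ★.

## References
* [HarishChandra1970] Harish-Chandra (notes by G. van Dijk), *Harmonic Analysis on Reductive p-adic Groups*, LNM 162 (1970), Part VII §1 Thm. 15.
* [WeilBNT1967] A. Weil, *Basic Number Theory* (1967), Ch. I §2 Cor. 3 of Thm. 3 (moduli along a quadratic extension).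
* [Folland1999] G. B. Folland, *Real Analysis* (2nd ed., 1999), §11.1 Thm. 11.9 (uniqueness of Haar measure).
* [Rogawski1990] J. D. Rogawski, *Automorphic Representations of Unitary Groups in Three Variables* (1990), §4.9 p. 54.
-/

set_option autoImplicit false
set_option linter.dupNamespace false

noncomputable section

open MeasureTheory MeasureTheory.Measure Filter Topology Set
open scoped ENNReal NNReal
open Literature.NumberTheory.GaloisRepresentations Literature.NumberTheory.GaloisRepresentations.IsNonarchimedeanLocalField
open Literature.NumberTheory.Automorphic Literature.MeasureTheory.Group Literature.NumberTheory.LocalFields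
open Summit.HodgeConjecture.HodgeConjecture.Cruxes.H413.F0P3cStCharTSHCDCoordinates
open Summit.HodgeConjecture.HodgeConjecture.Cruxes.H413.F0P3cStCharTSCuspDiscriminantNegHalf

namespace Summit.HodgeConjecture.HodgeConjecture.Cruxes.H413.K2E3HCDCuspDockingRpow

/-! ## §1 `ℝ≥0∞` bookkeeping: `N = n² ⇒ (↑N)^(−r) = (↑n)^(−(2r))` -/

/-- The docking algebra in one line: if `N = n ^ 2` in `ℝ≥0` then `(↑N) ^ (−r) = (↑n) ^ (−(2r))` in `[0, ∞]`, every real `r` (the quadratic norm bridge moves the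
exponent from the `normAbs K`-level `r` to the `normAbs F′`-level `2r`). [cite: WeilBNT1967, Ch. I §2 Cor. 3 of Thm. 3] -/
theorem coe_rpow_neg_of_eq_sq {N n : ℝ≥0} (h : N = n ^ 2) (r : ℝ) :
    ((N : ℝ≥0∞)) ^ (-r) = ((n : ℝ≥0∞)) ^ (-(2 * r)) := by
  rw [h, ENNReal.coe_pow, ← ENNReal.rpow_natCast, ← ENNReal.rpow_mul]
  congr 1
  push_cast
  ring

/-! ## §2 The cusp integrand read through the Chevalley-target chart `Φ_A` -/

section Frame

variable {K : Type*} [Field K] [ValuativeRel K] [TopologicalSpace K] [IsNonarchimedeanLocalField K]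
  {F' : Type*} [Field F'] [ValuativeRel F'] [TopologicalSpace F'] [IsNonarchimedeanLocalField F']

/-- **The cusp integrand in coordinates, exponent `r`.**  If `↑(Φ x) = (ι x₀, lam · ι x₁)`, `−4(ι a)³ − 27(lam · ι b)² = ι(−4a³ − 27 m b²)` and `|ι y|_K = |y|²_{F′}`,
then `(↑|−4 (Φ x).1³ − 27 (Φ x).2²|_K)^(−r) = (↑|−4x₀³ − 27 m x₁²|_{F′})^(−(2r))`. [cite: WeilBNT1967, Ch. I §2 Cor. 3 of Thm. 3] [cite: Rogawski1990, §4.9 p. 54] -/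
theorem cusp_rpow_coords_eq (ι : F' →+* K) (hιn : ∀ y : F', normAbs K (ι y) = normAbs F' y ^ 2) (lam : Kˣ) {m : F'}
    (hdisc : ∀ a b : F', -4 * ι a ^ 3 - 27 * ((lam : K) * ι b) ^ 2 = ι (-4 * a ^ 3 - 27 * m * b ^ 2))
    {A : AddSubgroup (K × K)} (Φ : (Fin 2 → F') ≃ₜ+ ↥A) (hΦ : ∀ x : Fin 2 → F', ((Φ x : ↥A) : K × K) = (ι (x 0), (lam : K) * ι (x 1)))
    (x : Fin 2 → F') (r : ℝ) :
    ((normAbs K (-4 * ((Φ x : ↥A) : K × K).1 ^ 3 - 27 * ((Φ x : ↥A) : K × K).2 ^ 2) : ℝ≥0∞)) ^ (-r) =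
      ((normAbs F' (-4 * x 0 ^ 3 - 27 * m * x 1 ^ 2) : ℝ≥0∞)) ^ (-(2 * r)) := by
  rw [hΦ x]
  exact coe_rpow_neg_of_eq_sq (by rw [hdisc, hιn]) r

/-! ## §3 The docking theorems at exponent `r` (`12 r < 5`) -/

/-- **(HC)ᵣ «CUSP DOCKING ON `↥A`», chart letters.**  Given ANY continuous additive isomorphism `Φ : (Fin 2 → F′) ≃ₜ+ ↥A` reading `↑(Φ x) = (ι x₀, lam · ι x₁)`, `m ≠ 0` in `F′`
with `ι m = lam²`, the quadratic norm bridge `hιn`, `(6 : F′) ≠ 0`, and `12 r < 5`: for ANY additive Haar measure `ν` on `↥A`, `(↑|−4c³ − 27d²|_K)^(−r)` is locally `∫⁻`-finite at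
every point of `↥A`.  Proof: ★ (D3c) at `s = 2r` (`6s < 5`, `d := m`) on `Fin 2 → F′` + ★ (G-FUB) along `Φ`. [cite: HarishChandra1970, Part VII §1 Thm. 15] [cite: Folland1999, §11.1 Thm. 11.9] -/
theorem forall_exists_nhds_setLIntegral_cusp_rpow_lt_top_of_chart
    (ι : F' →+* K) (hιn : ∀ y : F', normAbs K (ι y) = normAbs F' y ^ 2) (lam : Kˣ)
    {m : F'} (hm : ι m = (lam : K) ^ 2) (hm0 : m ≠ 0) (h6 : (6 : F') ≠ 0)
    {A : AddSubgroup (K × K)} (Φ : (Fin 2 → F') ≃ₜ+ ↥A) (hΦ : ∀ x : Fin 2 → F', ((Φ x : ↥A) : K × K) = (ι (x 0), (lam : K) * ι (x 1)))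
    [MeasurableSpace ↥A] [BorelSpace ↥A] (ν : Measure ↥A) [ν.IsAddHaarMeasure] {r : ℝ} (hr5 : 12 * r < 5) :
    ∀ a₀ : ↥A, ∃ W ∈ 𝓝 a₀, ∫⁻ a in W,
      ((normAbs K (-4 * (a : K × K).1 ^ 3 - 27 * (a : K × K).2 ^ 2) : ℝ≥0∞)) ^ (-r) ∂ν < ∞ := by
  classical
  -- ===== instances on the coordinate field `F′` (Borel structure fixed inside the proof) =====
  haveI : T2Space F' := (isLocalField F').toT2Space
  haveI := secondCountableTopology_localField F'
  letI : MeasurableSpace F' := borel F'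
  haveI : BorelSpace F' := ⟨rfl⟩
  -- ===== instances on `↥A`, transported along `Φ` =====
  haveI : LocallyCompactSpace ↥A := Φ.toHomeomorph.symm.isClosedEmbedding.locallyCompactSpace
  haveI : SecondCountableTopology ↥A := Φ.toHomeomorph.symm.secondCountableTopology
  -- ===== a Haar measure on `F′` and the product Haar measure on `Fin 2 → F′` =====
  set μ : Measure F' := Measure.addHaar with hμ
  haveI : (Measure.pi fun _ : Fin 2 => μ).IsAddHaarMeasure := Measure.pi.isAddHaarMeasure _
  -- ===== the cusp discriminant in coordinates =====
  have hdisc : ∀ a b : F', -4 * ι a ^ 3 - 27 * ((lam : K) * ι b) ^ 2 = ι (-4 * a ^ 3 - 27 * m * b ^ 2) := fun a b => by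
    simp only [map_sub, map_mul, map_neg, map_pow, map_ofNat, hm]
    ring
  -- ===== the integrand and its coordinate reading =====
  set f : ↥A → ℝ≥0∞ := fun a =>
    ((normAbs K (-4 * (a : K × K).1 ^ 3 - 27 * (a : K × K).2 ^ 2) : ℝ≥0∞)) ^ (-r) with hfdef
  have hfΦ : ∀ x : Fin 2 → F', f (Φ x) = ((normAbs F' (-4 * x 0 ^ 3 - 27 * m * x 1 ^ 2) : ℝ≥0∞)) ^ (-(2 * r)) :=
    fun x => cusp_rpow_coords_eq ι hιn lam hdisc Φ hΦ x r
  -- ===== ★ (D3c) at `s = 2r` on the coordinate plane, ★ (G-FUB) back to `↥A` =====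
  have hD3c := forall_exists_nhds_setLIntegral_cuspDiscriminant_rpow_neg_lt_top μ hm0 h6 (s := 2 * r) (by linarith)
  refine (forall_exists_nhds_setLIntegral_lt_top_iff_of_addEquiv Φ (Measure.pi fun _ : Fin 2 => μ) ν f).2 fun w => ?_
  obtain ⟨U, hU, hfin⟩ := hD3c w
  refine ⟨U, hU, ?_⟩
  have hcongr : ∫⁻ v in U, f (Φ v) ∂(Measure.pi fun _ : Fin 2 => μ) =
      ∫⁻ v in U, ((normAbs F' (-4 * v 0 ^ 3 - 27 * m * v 1 ^ 2) : ℝ≥0∞)) ^ (-(2 * r)) ∂(Measure.pi fun _ : Fin 2 => μ) :=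
    lintegral_congr fun v => hfΦ v
  rw [hcongr]
  exact hfin

/-- **(HC)ᵣ «CUSP DOCKING ON `↥A`», norm-bridge letter** (GLOBAL's letter `hιn`; ★ (NB) discharges it): for ANY additive Haar measure `ν` on `↥A` and `12 r < 5`, every
`a₀ : ↥A` has a neighbourhood `W` with `∫⁻ a in W, (↑|−4 a.1³ − 27 a.2²|_K)^(−r) ∂ν < ∞`.  Proof: ★ (CO) chart `Φ_A`, `lam² = ι m` (`m ≠ 0` as `lam ≠ 0`, `(6 : F′) ≠ 0` as `ι`
is injective) + `…_of_chart`. [cite: HarishChandra1970, Part VII §1 Thm. 15] [cite: Rogawski1990, §4.9 p. 54] [cite: Folland1999, §11.1 Thm. 11.9] -/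
theorem forall_exists_nhds_setLIntegral_cusp_rpow_lt_top_of_normBridge
    (σ : K →+* K) (h2 : (2 : K) ≠ 0) (h3 : (3 : K) ≠ 0)
    (ι : F' →+* K) (hι : IsClosedEmbedding ι) (hιr : ∀ x, σ x = x ↔ x ∈ Set.range ι)
    (hιn : ∀ y : F', normAbs K (ι y) = normAbs F' y ^ 2)
    (lam : Kˣ) (hlam : σ (lam : K) = -(lam : K))
    (A : AddSubgroup (K × K)) (hA : ∀ p : K × K, p ∈ A ↔ σ p.1 = p.1 ∧ σ p.2 = -p.2)
    [MeasurableSpace ↥A] [BorelSpace ↥A] (ν : Measure ↥A) [ν.IsAddHaarMeasure] {r : ℝ} (hr5 : 12 * r < 5) :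
    ∀ a₀ : ↥A, ∃ W ∈ 𝓝 a₀, ∫⁻ a in W,
      ((normAbs K (-4 * (a : K × K).1 ^ 3 - 27 * (a : K × K).2 ^ 2) : ℝ≥0∞)) ^ (-r) ∂ν < ∞ := by
  -- ===== ★ (CO): the chart `Φ_A` and `lam² = ι m` =====
  obtain ⟨Φ, hΦ, -⟩ := exists_coords_chevalleyTarget σ ι hι hιr lam hlam A hA
  obtain ⟨m, hm, -⟩ := exists_sq_eq_and_cusp_discr σ ι hιr lam hlam
  -- ===== constants: `m ≠ 0`, `(6 : F′) ≠ 0` =====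
  have hm0 : m ≠ 0 := by
    intro h
    apply lam.ne_zero
    have h0 : (lam : K) ^ 2 = 0 := by rw [← hm, h, map_zero]
    exact pow_eq_zero_iff (two_ne_zero) |>.1 h0
  have h6 : (6 : K) ≠ 0 := by
    rw [show (6 : K) = 2 * 3 by norm_num]; exact mul_ne_zero h2 h3
  have h6' : (6 : F') ≠ 0 := fun h => h6 (by rw [← map_ofNat ι 6, h, map_zero])
  exact forall_exists_nhds_setLIntegral_cusp_rpow_lt_top_of_chart ι hιn lam hm hm0 h6' Φ hΦ ν hr5

/-- **(HC)ᵣ «CUSP DOCKING ON `↥A`» — THE HEAD AT EXPONENT `r`.**  `K`, `F′` non-archimedean local fields, `σ : K →+* K` an involution with fixed field `ι F′` (`ι` a closed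
embedding), `lam` a skew unit, `(2 : K) ≠ 0`, `(3 : K) ≠ 0`, `A ≤ K × K` ANY additive subgroup with `p ∈ A ↔ σ p.1 = p.1 ∧ σ p.2 = −p.2`, `ν` ANY additive Haar measure on `↥A`,
`12 r < 5`: **`∀ a₀ : ↥A, ∃ W ∈ 𝓝 a₀, ∫⁻ a in W, (↑|−4 a.1³ − 27 a.2²|_K)^(−r) ∂ν < ∞`** — the `hcusp` input of (ε1) `K2E3HCDRegularPointsRpow` (binders = ★ (HC) head + `{r} (hr5)`);
the norm bridge is discharged by ★ (NB) `normAbs_map_eq_sq_of_involution`. [cite: HarishChandra1970, Part VII §1 Thm. 15] [cite: WeilBNT1967, Ch. I §2 Cor. 3 of Thm. 3]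
[cite: Folland1999, §11.1 Thm. 11.9] -/
theorem forall_exists_nhds_setLIntegral_cusp_rpow_lt_top
    (σ : K →+* K) (hσ : ∀ x, σ (σ x) = x) (h2 : (2 : K) ≠ 0) (h3 : (3 : K) ≠ 0)
    (ι : F' →+* K) (hι : IsClosedEmbedding ι) (hιr : ∀ x, σ x = x ↔ x ∈ Set.range ι)
    (lam : Kˣ) (hlam : σ (lam : K) = -(lam : K))
    (A : AddSubgroup (K × K)) (hA : ∀ p : K × K, p ∈ A ↔ σ p.1 = p.1 ∧ σ p.2 = -p.2)
    [MeasurableSpace ↥A] [BorelSpace ↥A] (ν : Measure ↥A) [ν.IsAddHaarMeasure] {r : ℝ} (hr5 : 12 * r < 5) :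
    ∀ a₀ : ↥A, ∃ W ∈ 𝓝 a₀, ∫⁻ a in W,
      ((normAbs K (-4 * (a : K × K).1 ^ 3 - 27 * (a : K × K).2 ^ 2) : ℝ≥0∞)) ^ (-r) ∂ν < ∞ := by
  haveI : Invertible (2 : K) := invertibleOfNonzero h2
  exact forall_exists_nhds_setLIntegral_cusp_rpow_lt_top_of_normBridge σ h2 h3 ι hι hιr
    (normAbs_map_eq_sq_of_involution ι hι.continuous σ hσ hιr lam hlam) lam hlam A hA ν hr5

/-- **(HC)ᵣ, pointwise form** (one `a₀ : ↥A`). [cite: HarishChandra1970, Part VII §1 Thm. 15] -/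
theorem exists_nhds_setLIntegral_cusp_rpow_lt_top
    (σ : K →+* K) (hσ : ∀ x, σ (σ x) = x) (h2 : (2 : K) ≠ 0) (h3 : (3 : K) ≠ 0)
    (ι : F' →+* K) (hι : IsClosedEmbedding ι) (hιr : ∀ x, σ x = x ↔ x ∈ Set.range ι)
    (lam : Kˣ) (hlam : σ (lam : K) = -(lam : K))
    (A : AddSubgroup (K × K)) (hA : ∀ p : K × K, p ∈ A ↔ σ p.1 = p.1 ∧ σ p.2 = -p.2)
    [MeasurableSpace ↥A] [BorelSpace ↥A] (ν : Measure ↥A) [ν.IsAddHaarMeasure] {r : ℝ} (hr5 : 12 * r < 5) (a₀ : ↥A) :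
    ∃ W ∈ 𝓝 a₀, ∫⁻ a in W,
      ((normAbs K (-4 * (a : K × K).1 ^ 3 - 27 * (a : K × K).2 ^ 2) : ℝ≥0∞)) ^ (-r) ∂ν < ∞ :=
  forall_exists_nhds_setLIntegral_cusp_rpow_lt_top σ hσ h2 h3 ι hι hιr lam hlam A hA ν hr5 a₀

end Frame

end Summit.HodgeConjecture.HodgeConjecture.Cruxes.H413.K2E3HCDCuspDockingRpow

end
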